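import Summits.CriticalPhenomena.PercolationContinuityZ3.Theorems.PercNearOneGluingNoHeavyQuantFarTreeCherryComb
import Summits.CriticalPhenomena.PercolationContinuityZ3.Theorems.PercNearOneGluingNoHeavyQuantFarRelayRowBlockCombRow
import HarnessLib

/-!
# QUANT lane R8 beyond block-combs: THE CHERRY-COMB ROW in ROUTE VOCABULARY — `Quant.FarRelayRow`'s body at every layer, under FAR's own
# hypothesis `2j < Σ_{b∈A} P(o ↔ b)`, for every tree-supported weight pattern presented as a block-comb with unit cherries / two-relay hairs

builds on p205010 (kernel theorem, internal audit signed; external expert review pending)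

Support file (`--supports stmt-CriticalPhenomena-4575`), QUANT lane seat prim-quant-p1 (gen 10); memo `run/shared/lean/prim/quant/P1-SURPLUS.md` §21.
The wrapper of `Quant.CherryCombGate.farTree_cherryComb_of_mean` (`…QuantFarTreeCherryComb.lean`, same seat: the stemmed canonical row
`Quant.CherryComb.tail_ge_of_cherryComb` in gate coordinates) along `Quant.tree_relayCount_transfer` / `Quant.tree_real_openConn_eq_prod`, in the
pattern of p1 g9's `Quant.farRelayRow_tree_blockComb` (`…QuantFarRelayRowBlockCombRow.lean`), whose block-comb presentations are the case `st = id`.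
Theorems only; no sorries; standard axioms.

* `Quant.farRelayRow_tree_cherryComb` — **ROUTE VOCABULARY: the body of `Quant.FarRelayRow` at EVERY layer `j`, under its own hypotheses
  `2j < Σ_{b∈A} P(o ↔ b)` and `P(o ↮ b) ≤ t` on `A`, for every weight function on `Sym2 (Fin n)` supported on a rooted spanning tree (root =
  observer `o ∉ A`) whose relay set carries a STEMMED BLOCK-COMB PRESENTATION covering `A`**: a chain `ch` (injective), pieces `k` with classes
  `R k ⊆ A` (pairwise disjoint, covering `A`), pairwise disjoint private vertex sets `G k` off the chain, levels `lv k ≤ D` and stems `st k`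
  (stemless, at the level of their leaves, every leaf `k` — `st k ≠ k` — in a UNIT CHERRY: `R (st k) = ∅` and exactly one partner leaf `k' ≠ k`
  with `|R k'| = |R k|`), such that the root path of every relay of class `k` is `ch''{i < lv k} ∪ G (st k) ∪ G k`.  Then
  `P(#{b ∈ A | o ↔ b} ≤ j) ≤ t`.  In words: FAR at every layer for every rooted tree whose relay-free vertices off one chain below the observer
  are (i) inner vertices of private paths (block-combs: p1 g9 / census-1 g13) or (ii) branch points carrying exactly two relay classes of equal
  size on private paths (unit cherries), and whose relays below other relays off the chain are single classes of the same size one private path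
  further down (unit two-relay hairs) — stars, block-stars, combs, block-combs with root blocks, multi-level hubs, now each decorated with any
  number of two-relay hairs and cherries at any chain vertices (LEAD-NOTES-G14 N25 (1): the first shape beyond block-combs).
* `Quant.farRelayRow_tree_cherryComb_root` — the `o ∈ A` cell (the observer a relay; presentation of `A.erase o`; layer shifted by one).
[cite: KozmaNitzan2024, Lemma 2 (p. 6), Conjecture 3 (p. 15)] for the row; the theorem is [this work]; mixture principle: prim-quant-census-1
GENERAL-ROW-G13 §7 (T4) (this lane).
-/

noncomputable section

namespace Summit.CriticalPhenomena.PercolationContinuityZ3.Theorems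

namespace Quant

open Finset MeasureTheory
open Literature.Probability.LatticeModels
open Literature.Probability.Percolation
open scoped Classical

variable {n : ℕ}

/-- **THE CHERRY-COMB ROW, route vocabulary: `Quant.FarRelayRow`'s body at every layer under its own hypotheses, for every tree-supported weight
pattern with a stemmed block-comb presentation (block-comb + unit cherries / unit two-relay hairs) covering the relays.**  Tree-supported weights
`w` on `Sym2 (Fin n)` (root `o`, coordinates `par`/`depth`, `hsupp`), relays `A ∌ o`, and a presentation (`ch`, `R`, `G`, `lv`, `st`): chain `ch`
(injective), classes `R k ⊆ A` pairwise disjoint and COVERING `A`, private vertex sets `G k` pairwise disjoint and off the chain, `lv k ≤ D`, stems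
`st` with `st (st k) = st k`, `lv (st k) = lv k`, every leaf in a unit cherry (`R (st k) = ∅`, one partner leaf `k' ≠ k`, `k' ≠ st k`, with
`st k' = st k`, `|R k'| = |R k|`, and no further piece with that stem), and for every `b ∈ R k` the root path `{par^[i] b | i ≤ depth b}` equals
`ch''{i < lv k} ∪ G (st k) ∪ G k`.  If `2j < Σ_{b∈A} P(o ↔ b)` and `P(o ↮ b) ≤ t` for all `b ∈ A`, then `P(#{b ∈ A | o ↔ b} ≤ j) ≤ t`. [this work] -/
theorem farRelayRow_tree_cherryComb (n : ℕ) (w : Sym2 (Fin n) → unitInterval) (o : Fin n)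
    (depth : Fin n → ℕ) (par : Fin n → Fin n)
    (hroot : ∀ x, x ≠ o → depth x = 0 → par x = o)
    (hstep : ∀ x, x ≠ o → depth x ≠ 0 → par x ≠ o ∧ depth (par x) + 1 = depth x)
    (hsupp : ∀ e, w e ≠ 0 → e.IsDiag ∨ ∃ x, x ≠ o ∧ e = s(par x, x))
    (A : Finset (Fin n)) (hoA : o ∉ A) (j : ℕ) (t : ℝ)
    {κ : Type*} [Fintype κ] [DecidableEq κ]
    (D : ℕ) (ch : Fin D → Fin n) (hch : Function.Injective ch)
    (G : κ → Finset (Fin n)) (hGdisj : ∀ k k', k ≠ k' → Disjoint (G k) (G k')) (hGch : ∀ k (i : Fin D), ch i ∉ G k)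
    (R : κ → Finset (Fin n)) (hRA : ∀ k, R k ⊆ A) (hRdisj : ∀ k k', k ≠ k' → Disjoint (R k) (R k'))
    (hcover : ∀ b ∈ A, ∃ k, b ∈ R k)
    (lv : κ → ℕ) (hlv : ∀ k, lv k ≤ D) (st : κ → κ) (hstem : ∀ k, st (st k) = st k) (hlvst : ∀ k, lv (st k) = lv k)
    (hcherry : ∀ k, st k ≠ k → (R (st k)).card = 0 ∧ ∃ k', k' ≠ k ∧ k' ≠ st k ∧ st k' = st k ∧ (R k').card = (R k).card ∧
      ∀ k'', st k'' = st k → k'' = st k ∨ k'' = k ∨ k'' = k')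
    (hpath : ∀ k, ∀ b ∈ R k, (Finset.range (depth b + 1)).image (fun i => par^[i] b) =
      ((Finset.univ : Finset (Fin D)).filter (fun i : Fin D => i.val < lv k)).image ch ∪ G (st k) ∪ G k)
    (hEN : (2 * j : ℝ) < ∑ b ∈ A, (prodBernoulli w).real (openConn o b))
    (ht : ∀ b ∈ A, (prodBernoulli w).real (openConn o b : Set (BondConfig (Fin n)))ᶜ ≤ t) :
    (prodBernoulli w).real {ω : BondConfig (Fin n) | (A.filter fun b => ω ∈ openConn o b).card ≤ j} ≤ t := by
  rw [tree_relayCount_transfer n w o depth par hroot hstep hsupp A j]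
  set q : Fin n → unitInterval := fun x => if x = o then 1 else w s(par x, x) with hq
  have hqy : ∀ y, y ≠ o → q y = w s(par y, y) := fun y hy => by simp only [hq, if_neg hy]
  have hAo : ∀ b ∈ A, b ≠ o := fun b hb hbo => hoA (hbo ▸ hb)
  -- the reached-class event contains the light relay-count event
  set F : Set (Set (Fin n)) := {ω' : Set (Fin n) | ∑ k ∈ Finset.univ.filter
      (fun k => (∀ i : Fin D, (i : ℕ) < lv k → ch i ∈ ω') ∧ ((G k : Finset (Fin n)) : Set (Fin n)) ⊆ ω' ∧
        ((G (st k) : Finset (Fin n)) : Set (Fin n)) ⊆ ω'), (R k).card ≤ j} with hF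
  have hsub : {ω' : Set (Fin n) | (A.filter fun a => a = o ∨ ∀ i, i ≤ depth a → par^[i] a ∈ ω').card ≤ j} ⊆ F := by
    intro ω' hω'
    have hle : (A.filter fun a => a = o ∨ ∀ i, i ≤ depth a → par^[i] a ∈ ω').card ≤ j := hω'
    show ∑ k ∈ Finset.univ.filter
      (fun k => (∀ i : Fin D, (i : ℕ) < lv k → ch i ∈ ω') ∧ ((G k : Finset (Fin n)) : Set (Fin n)) ⊆ ω' ∧
        ((G (st k) : Finset (Fin n)) : Set (Fin n)) ⊆ ω'), (R k).card ≤ j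
    set Kr : Finset κ := Finset.univ.filter
      (fun k => (∀ i : Fin D, (i : ℕ) < lv k → ch i ∈ ω') ∧ ((G k : Finset (Fin n)) : Set (Fin n)) ⊆ ω' ∧
        ((G (st k) : Finset (Fin n)) : Set (Fin n)) ⊆ ω') with hKr
    have hreach : ∀ k ∈ Kr, ∀ b ∈ R k, (b = o ∨ ∀ i, i ≤ depth b → par^[i] b ∈ ω') := by
      intro k hk b hb
      obtain ⟨-, hpre, hG, hGst⟩ := Finset.mem_filter.1 hk
      refine Or.inr fun i hi => ?_
      have hmem : par^[i] b ∈ (Finset.range (depth b + 1)).image (fun i => par^[i] b) :=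
        Finset.mem_image.2 ⟨i, Finset.mem_range.2 (by omega), rfl⟩
      rw [hpath k b hb, Finset.mem_union, Finset.mem_union] at hmem
      rcases hmem with (h | h) | h
      · obtain ⟨i', hi', he⟩ := Finset.mem_image.1 h
        rw [← he]
        exact hpre i' (Finset.mem_filter.1 hi').2
      · exact hGst (Finset.mem_coe.2 h)
      · exact hG (Finset.mem_coe.2 h)
    have hcard : ∑ k ∈ Kr, (R k).card = (Kr.biUnion R).card := by
      rw [Finset.card_biUnion]
      intro k _ k' _ hkk'
      exact hRdisj k k' hkk'
    have hsubset : Kr.biUnion R ⊆ A.filter fun a => a = o ∨ ∀ i, i ≤ depth a → par^[i] a ∈ ω' := by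
      intro b hb
      obtain ⟨k, hk, hbk⟩ := Finset.mem_biUnion.1 hb
      exact Finset.mem_filter.2 ⟨hRA k hbk, hreach k hk b hbk⟩
    calc ∑ k ∈ Kr, (R k).card = (Kr.biUnion R).card := hcard
      _ ≤ (A.filter fun a => a = o ∨ ∀ i, i ≤ depth a → par^[i] a ∈ ω').card := Finset.card_le_card hsubset
      _ ≤ j := hle
  refine le_trans (measureReal_mono hsub (measure_ne_top _ _)) ?_
  -- the marginal of a relay `b ∈ R k` is the canonical marginal of its class
  have hmarg : ∀ k, ∀ b ∈ R k, (prodBernoulli w).real (openConn o b) =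
      (∏ i ∈ Finset.range (lv k), (if h : i < D then ((q (ch ⟨i, h⟩) : unitInterval) : ℝ) else 1)) *
        (if st k = k then ∏ e ∈ G k, (q e : ℝ) else (∏ e ∈ G (st k), (q e : ℝ)) * ∏ e ∈ G k, (q e : ℝ)) := by
    intro k b hb
    have hbA : b ∈ A := hRA k hb
    have hbo : b ≠ o := hAo b hbA
    rw [tree_real_openConn_eq_prod n w o depth par hroot hstep hsupp b hbo]
    have hprod : ∏ i ∈ Finset.range (depth b + 1), (w s(par (par^[i] b), par^[i] b) : ℝ) =
        ∏ y ∈ (Finset.range (depth b + 1)).image (fun i => par^[i] b), (q y : ℝ) := by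
      rw [Finset.prod_image (tree_iterate_injOn o depth par hstep b hbo)]
      refine Finset.prod_congr rfl fun i hi => ?_
      have hne := (tree_iterate_par o depth par hstep b hbo i (by have := Finset.mem_range.1 hi; omega)).1
      rw [hqy _ hne]
    have hdisj1 : ∀ k', Disjoint (((Finset.univ : Finset (Fin D)).filter (fun i : Fin D => i.val < lv k)).image ch) (G k') := by
      intro k'
      rw [Finset.disjoint_left]
      intro y hy hyG
      obtain ⟨i, -, rfl⟩ := Finset.mem_image.1 hy
      exact hGch k' i hyG
    have hrange : ∏ i ∈ Finset.range (lv k), (if h : i < D then ((q (ch ⟨i, h⟩) : unitInterval) : ℝ) else 1) =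
        ∏ i ∈ Finset.range D, (if i < lv k then
          (if h : i < D then ((q (ch ⟨i, h⟩) : unitInterval) : ℝ) else 1) else 1) := by
      rw [← Finset.prod_filter]
      refine Finset.prod_congr ?_ fun _ _ => rfl
      ext i; simp only [Finset.mem_range, Finset.mem_filter]; have := hlv k; omega
    have hchain : ∏ y ∈ ((Finset.univ : Finset (Fin D)).filter (fun i : Fin D => i.val < lv k)).image ch, (q y : ℝ) =
        ∏ i ∈ Finset.range (lv k), (if h : i < D then ((q (ch ⟨i, h⟩) : unitInterval) : ℝ) else 1) := by
      rw [Finset.prod_image (fun i _ i' _ h => hch h), Finset.prod_filter, hrange,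
        ← Fin.prod_univ_eq_prod_range (fun m => if m < lv k then
          (if h : m < D then ((q (ch ⟨m, h⟩) : unitInterval) : ℝ) else 1) else 1) D]
      refine Finset.prod_congr rfl fun i _ => ?_
      by_cases hi : (i : ℕ) < lv k
      · rw [if_pos hi, if_pos hi, dif_pos i.2]
      · rw [if_neg hi, if_neg hi]
    rw [hprod, hpath k b hb]
    by_cases hsk : st k = k
    · rw [if_pos hsk, show G (st k) = G k by rw [hsk], Finset.union_assoc, Finset.union_idempotent,
        Finset.prod_union (hdisj1 k), hchain]
    · have hdisj2 : Disjoint (((Finset.univ : Finset (Fin D)).filter (fun i : Fin D => i.val < lv k)).image ch ∪ G (st k)) (G k) := by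
        rw [Finset.disjoint_union_left]
        exact ⟨hdisj1 k, hGdisj _ _ hsk⟩
      rw [Finset.prod_union hdisj2, Finset.prod_union (hdisj1 (st k)), hchain, if_neg hsk, mul_assoc]
  -- the light hypothesis: the marginal of a live class is the marginal of each of its relays
  have hlive : ∀ k, 0 < (R k).card ↔ (R k).Nonempty := fun k => Finset.card_pos
  have ht' : ∀ k, 0 < (R k).card →
      1 - (∏ i ∈ Finset.range (lv k), (if h : i < D then ((q (ch ⟨i, h⟩) : unitInterval) : ℝ) else 1)) *
        (if st k = k then ∏ e ∈ G k, (q e : ℝ) else (∏ e ∈ G (st k), (q e : ℝ)) * ∏ e ∈ G k, (q e : ℝ)) ≤ t := by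
    intro k hk
    obtain ⟨b, hb⟩ := (hlive k).1 hk
    have htb := ht b (hRA k hb)
    rw [probReal_compl_eq_one_sub (Set.toFinite _).measurableSet, hmarg k b hb] at htb
    exact htb
  -- the mean: `Σ_{b∈A} P(o ↔ b) = Σ_k |R k| · marginal k`
  have hmean : (2 * j : ℝ) < ∑ k, ((R k).card : ℝ) *
      ((∏ i ∈ Finset.range (lv k), (if h : i < D then ((q (ch ⟨i, h⟩) : unitInterval) : ℝ) else 1)) *
        (if st k = k then ∏ e ∈ G k, (q e : ℝ) else (∏ e ∈ G (st k), (q e : ℝ)) * ∏ e ∈ G k, (q e : ℝ))) := by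
    have hU : (Finset.univ : Finset κ).biUnion R = A := by
      refine Finset.Subset.antisymm (Finset.biUnion_subset.2 fun k _ => hRA k) fun b hb => ?_
      obtain ⟨k, hk⟩ := hcover b hb
      exact Finset.mem_biUnion.2 ⟨k, Finset.mem_univ _, hk⟩
    have hsum : ∑ b ∈ A, (prodBernoulli w).real (openConn o b) =
        ∑ k, ∑ b ∈ R k, (prodBernoulli w).real (openConn o b) := by
      rw [← hU, Finset.sum_biUnion (fun k _ k' _ hkk' => hRdisj k k' hkk')]
    rw [hsum] at hEN
    refine hEN.trans_le (le_of_eq (Finset.sum_congr rfl fun k _ => ?_))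
    rw [Finset.sum_congr rfl fun b hb => hmarg k b hb, Finset.sum_const, nsmul_eq_mul]
  exact CherryCombGate.farTree_cherryComb_of_mean q D ch hch G hGdisj hGch lv hlv (fun k => (R k).card) st hstem hlvst hcherry j t
    hmean ht'

/-- **The `o ∈ A` cell** of `Quant.farRelayRow_tree_cherryComb`: the observer itself a relay (always counted, `P(o ↔ o) = 1`); the presentation
covers `A.erase o`; FAR's hypothesis `2j < Σ_{b∈A} P(o ↔ b)` at layer `j` gives the covered mean `> 2j − 1 ≥ 2(j−1)` at the shifted layer. [this work] -/
theorem farRelayRow_tree_cherryComb_root (n : ℕ) (w : Sym2 (Fin n) → unitInterval) (o : Fin n)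
    (depth : Fin n → ℕ) (par : Fin n → Fin n)
    (hroot : ∀ x, x ≠ o → depth x = 0 → par x = o)
    (hstep : ∀ x, x ≠ o → depth x ≠ 0 → par x ≠ o ∧ depth (par x) + 1 = depth x)
    (hsupp : ∀ e, w e ≠ 0 → e.IsDiag ∨ ∃ x, x ≠ o ∧ e = s(par x, x))
    (A : Finset (Fin n)) (hoA : o ∈ A) (j : ℕ) (t : ℝ)
    {κ : Type*} [Fintype κ] [DecidableEq κ]
    (D : ℕ) (ch : Fin D → Fin n) (hch : Function.Injective ch)
    (G : κ → Finset (Fin n)) (hGdisj : ∀ k k', k ≠ k' → Disjoint (G k) (G k')) (hGch : ∀ k (i : Fin D), ch i ∉ G k)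
    (R : κ → Finset (Fin n)) (hRA : ∀ k, R k ⊆ A.erase o) (hRdisj : ∀ k k', k ≠ k' → Disjoint (R k) (R k'))
    (hcover : ∀ b ∈ A.erase o, ∃ k, b ∈ R k)
    (lv : κ → ℕ) (hlv : ∀ k, lv k ≤ D) (st : κ → κ) (hstem : ∀ k, st (st k) = st k) (hlvst : ∀ k, lv (st k) = lv k)
    (hcherry : ∀ k, st k ≠ k → (R (st k)).card = 0 ∧ ∃ k', k' ≠ k ∧ k' ≠ st k ∧ st k' = st k ∧ (R k').card = (R k).card ∧
      ∀ k'', st k'' = st k → k'' = st k ∨ k'' = k ∨ k'' = k')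
    (hpath : ∀ k, ∀ b ∈ R k, (Finset.range (depth b + 1)).image (fun i => par^[i] b) =
      ((Finset.univ : Finset (Fin D)).filter (fun i : Fin D => i.val < lv k)).image ch ∪ G (st k) ∪ G k)
    (hEN : (2 * j : ℝ) < ∑ b ∈ A, (prodBernoulli w).real (openConn o b))
    (ht : ∀ b ∈ A, (prodBernoulli w).real (openConn o b : Set (BondConfig (Fin n)))ᶜ ≤ t) :
    (prodBernoulli w).real {ω : BondConfig (Fin n) | (A.filter fun b => ω ∈ openConn o b).card ≤ j} ≤ t := by
  have ht0 : 0 ≤ t := le_trans measureReal_nonneg (ht o hoA)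
  have hcard := QuantCensus.card_filter_conn_eq_erase_add_one A o hoA
  have hoA' : o ∉ A.erase o := Finset.notMem_erase o A
  rcases Nat.eq_zero_or_pos j with hj | hj
  · subst hj
    have hempty : {ω : BondConfig (Fin n) | (A.filter fun b => ω ∈ openConn o b).card ≤ 0} = ∅ := by
      rw [Set.eq_empty_iff_forall_notMem]
      intro ω hω
      have h1 := hcard ω
      have h2 : (A.filter fun b => ω ∈ openConn o b).card ≤ 0 := hω
      omega
    rw [hempty, measureReal_empty]
    exact ht0
  · obtain ⟨j', rfl⟩ : ∃ j', j = j' + 1 := ⟨j - 1, by omega⟩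
    have hEN' : (2 * j' : ℝ) < ∑ b ∈ A.erase o, (prodBernoulli w).real (openConn o b) := by
      have hsplit := Finset.sum_erase_add A (fun b => (prodBernoulli w).real (openConn o b)) hoA
      have hoo : (prodBernoulli w).real (openConn o o) ≤ 1 := by
        haveI : IsProbabilityMeasure (prodBernoulli w) := inferInstance
        exact measureReal_le_one
      have h1 : (2 * ((j' + 1 : ℕ) : ℝ)) = 2 * j' + 2 := by push_cast; ring
      rw [h1] at hEN
      linarith
    have hfar := farRelayRow_tree_cherryComb n w o depth par hroot hstep hsupp (A.erase o) hoA' j' t D ch hch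
      G hGdisj hGch R hRA hRdisj hcover lv hlv st hstem hlvst hcherry hpath hEN' (fun b hb => ht b (Finset.mem_of_mem_erase hb))
    have hset : {ω : BondConfig (Fin n) | (A.filter fun b => ω ∈ openConn o b).card ≤ j' + 1} =
        {ω | ((A.erase o).filter fun b => ω ∈ openConn o b).card ≤ j'} := by
      ext ω
      simp only [Set.mem_setOf_eq]
      rw [hcard ω]
      omega
    rw [hset]
    exact hfar

end Quant

end Summit.CriticalPhenomena.PercolationContinuityZ3.Theorems
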